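import Summits.QuantumFields.GaugeBoot.DiagonalRPTorusInnerHalfNegativeThreeUniform
import Summits.QuantumFields.GaugeBoot.DiagonalRPTorusInnerHalfNegativeThreeAll
import HarnessLib

/-!
# One coupling window for ALL even three-tori (gauge-boot, L3 `d = 3` uniform window, corollary)

HONEST FRAMING (cell `pub-gaugeboot`, page 1 of every file): the venture produces certified bounds
on lattice expectations at stated coupling, gauge group, dimension and torus size; NOT a mass gap,
NOT a continuum limit, NOT a string tension; NOT Yang–Mills-summit-bearing (barriers
`FixedCouplingUltralocality`, `PerturbativeInvisibility`). A structural NEGATIVE result about a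
reflection-positivity hypothesis on discrete tori; it certifies no bound of the venture.

## Content (torus `(ℤ/L)^3`, mirror `y₀ = y₁`)

`DiagonalRPTorusInnerHalfNegativeThreeUniform` gives ONE window `β₀` for every even `L ≥ 36`
(lean3 gen 47); `DiagonalRPTorusInnerHalfNegativeThreeAll` gives a window `β₀(L)` for each even
`L ≥ 4` (lean3 gen 44). Taking the minimum over the finitely many small tori:

* ★★★ **`not_innerDiagonalRP_even_three_allL_specialUnitary`** (`G ≅ SU(N)`, `N ≥ 2`) and
  ★★★ **`not_innerDiagonalRP_even_three_allL_unitary`** (`G ≅ U(N)`, `N ≥ 1`):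
  `∃ β₀ > 0, ∀ even L ≥ 4, ∀ 0 < β ≤ β₀, ¬ InnerDiagonalRP ρ β 0 1` on `(ℤ/L)^3` —
  the `d = 3` companion of `DiagRPUnif.diagonalRP_fails_suN_uniform` (`d ≥ 4`, lean3 gen 45).

No named fact; standard axioms.
-/

open MeasureTheory Finset Function

namespace Summit.QuantumFields.GaugeBoot

open Literature.MathematicalPhysics.QuantumFieldTheory

noncomputable section

namespace DiagRPHex

open DiagRPTube

variable {N : ℕ} {G : Type*} [Group G] [TopologicalSpace G] [IsTopologicalGroup G] [CompactSpace G]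
  [MeasurableSpace G] [BorelSpace G] [SecondCountableTopology G] (ρ : G →* Matrix (Fin N) (Fin N) ℂ)

/-- Gluing a uniform window above a threshold with pointwise windows below it. -/
theorem exists_uniform_window_of_threshold {P : ∀ (L : ℕ) [NeZero L], ℝ → Prop} {L₀ : ℕ}
    (hbig : ∃ β₀ : ℝ, 0 < β₀ ∧ ∀ (L : ℕ) [NeZero L], Even L → L₀ ≤ L → ∀ β : ℝ, 0 < β → β ≤ β₀ → P L β)
    (hsmall : ∀ (L : ℕ) [NeZero L], Even L → 4 ≤ L → ∃ β₀ : ℝ, 0 < β₀ ∧ ∀ β : ℝ, 0 < β → β ≤ β₀ → P L β) :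
    ∃ β₀ : ℝ, 0 < β₀ ∧ ∀ (L : ℕ) [NeZero L], Even L → 4 ≤ L → ∀ β : ℝ, 0 < β → β ≤ β₀ → P L β := by
  classical
  obtain ⟨βu, hβu, hu⟩ := hbig
  -- a positive window for every `L` (trivial where none is needed)
  have hs : ∀ L : ℕ, ∃ b : ℝ, 0 < b ∧
      ∀ [NeZero L], Even L → 4 ≤ L → ∀ β : ℝ, 0 < β → β ≤ b → P L β := by
    intro L
    by_cases h : Even L ∧ 4 ≤ L
    · haveI : NeZero L := ⟨by omega⟩
      obtain ⟨b, hb, hbb⟩ := hsmall L h.1 h.2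
      exact ⟨b, hb, fun _ _ β hβ hβb => hbb β hβ hβb⟩
    · exact ⟨1, one_pos, fun hE h4 => absurd ⟨hE, h4⟩ h⟩
  choose b hb hbb using hs
  have hne : (Finset.range (L₀ + 1)).Nonempty := ⟨0, by simp⟩
  set βs : ℝ := (Finset.range (L₀ + 1)).inf' hne b with hβs
  have hβs0 : 0 < βs := by
    rw [hβs, Finset.lt_inf'_iff]
    exact fun L _ => hb L
  refine ⟨min βu βs, lt_min hβu hβs0, fun L _ hE h4 β hβ hβ0 => ?_⟩
  rcases le_or_gt L₀ L with hL | hL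
  · exact hu L hE hL β hβ (hβ0.trans (min_le_left _ _))
  · have hmem : L ∈ Finset.range (L₀ + 1) := Finset.mem_range.2 (by omega)
    have hle : βs ≤ b L := Finset.inf'_le _ hmem
    exact hbb L hE h4 β hβ ((hβ0.trans (min_le_right _ _)).trans hle)

/-- ★★★ **`G ≅ SU(N)`, `N ≥ 2`: ONE window for ALL even three-tori**:
`∃ β₀ > 0, ∀ even L ≥ 4, ∀ 0 < β ≤ β₀, ¬ InnerDiagonalRP ρ β 0 1` on `(ℤ/L)^3`. -/
theorem not_innerDiagonalRP_even_three_allL_specialUnitary (hρ : IsSpecialUnitaryModel ρ) (hN : 2 ≤ N) :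
    ∃ β₀ : ℝ, 0 < β₀ ∧ ∀ (L : ℕ) [NeZero L], Even L → 4 ≤ L → ∀ β : ℝ, 0 < β → β ≤ β₀ →
      ¬ InnerDiagonalRP (d := 3) (L := L) ρ β 0 1 :=
  exists_uniform_window_of_threshold (P := fun L _ β => ¬ InnerDiagonalRP (d := 3) (L := L) ρ β 0 1)
    (not_innerDiagonalRP_even_three_uniform_specialUnitary ρ hρ hN)
    (fun _ _ hE h4 => DiagRPRest.not_innerDiagonalRP_even_three_specialUnitary ρ hρ hN hE h4)

/-- ★★★ **`G ≅ U(N)`, `N ≥ 1`: ONE window for ALL even three-tori.** -/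
theorem not_innerDiagonalRP_even_three_allL_unitary (hρ : IsUnitaryModel ρ) (hN : 1 ≤ N) :
    ∃ β₀ : ℝ, 0 < β₀ ∧ ∀ (L : ℕ) [NeZero L], Even L → 4 ≤ L → ∀ β : ℝ, 0 < β → β ≤ β₀ →
      ¬ InnerDiagonalRP (d := 3) (L := L) ρ β 0 1 :=
  exists_uniform_window_of_threshold (P := fun L _ β => ¬ InnerDiagonalRP (d := 3) (L := L) ρ β 0 1)
    (not_innerDiagonalRP_even_three_uniform_unitary ρ hρ hN)
    (fun _ _ hE h4 => DiagRPRest.not_innerDiagonalRP_even_three_unitary ρ hρ hN hE h4)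

/-- The back-gauge-invariant closed-half statement fails as well, uniformly, for `G ≅ SU(N)`. -/
theorem not_backInvariantDiagonalRP_even_three_allL_specialUnitary (hρ : IsSpecialUnitaryModel ρ)
    (hN : 2 ≤ N) :
    ∃ β₀ : ℝ, 0 < β₀ ∧ ∀ (L : ℕ) [NeZero L], Even L → 4 ≤ L → ∀ β : ℝ, 0 < β → β ≤ β₀ →
      ¬ BackInvariantDiagonalRP (d := 3) (L := L) ρ β 0 1 := by
  obtain ⟨β₀, hβ₀, h⟩ := not_innerDiagonalRP_even_three_allL_specialUnitary ρ hρ hN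
  exact ⟨β₀, hβ₀, fun L _ hE h4 β hβ hβ1 hB => h L hE h4 β hβ hβ1 hB.innerDiagonalRP⟩

/-! ## The concrete groups -/

section Groups

open Literature.MathematicalPhysics.QuantumLattice

/-- ★★★ **`SU(N)` lattice gauge theory (`N ≥ 2`) violates inner-half diagonal RP on EVERY even
three-torus `(ℤ/L)³`, `L ≥ 4`, for all `0 < β ≤ β₀(N)` with ONE `β₀(N) > 0`** (not vacuous: the
defining representation of `Matrix.specialUnitaryGroup`). -/
theorem not_innerDiagonalRP_even_three_allL_suN {N : ℕ} (hN : 2 ≤ N) :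
    ∃ β₀ : ℝ, 0 < β₀ ∧ ∀ (L : ℕ) [NeZero L], Even L → 4 ≤ L → ∀ β : ℝ, 0 < β → β ≤ β₀ →
      ¬ InnerDiagonalRP (d := 3) (L := L) (fundamentalRep (Fin N)) β 0 1 := by
  haveI : SecondCountableTopology (Matrix (Fin N) (Fin N) ℂ) :=
    inferInstanceAs (SecondCountableTopology (Fin N → Fin N → ℂ))
  haveI : SecondCountableTopology (Matrix.specialUnitaryGroup (Fin N) ℂ) :=
    Topology.IsEmbedding.subtypeVal.secondCountableTopology
  exact not_innerDiagonalRP_even_three_allL_specialUnitary (fundamentalRep (Fin N))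
    (TorusAreaLaw.isSpecialUnitaryModel_fundamentalRep N) hN

/-- ★★★ **`U(N)` lattice gauge theory (`N ≥ 1`; `N = 1`: compact `U(1)`) violates inner-half
diagonal RP on EVERY even three-torus `L ≥ 4` for all `0 < β ≤ β₀(N)` with ONE `β₀(N) > 0`.** -/
theorem not_innerDiagonalRP_even_three_allL_uN {N : ℕ} (hN : 1 ≤ N) :
    ∃ β₀ : ℝ, 0 < β₀ ∧ ∀ (L : ℕ) [NeZero L], Even L → 4 ≤ L → ∀ β : ℝ, 0 < β → β ≤ β₀ →
      ¬ InnerDiagonalRP (d := 3) (L := L) (unitaryFundamentalRep (Fin N) ℂ) β 0 1 := by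
  haveI : SecondCountableTopology (Matrix.unitaryGroup (Fin N) ℂ) :=
    IsUnitaryModel.secondCountableTopology _ (isUnitaryModel_unitaryFundamentalRep N)
  exact not_innerDiagonalRP_even_three_allL_unitary (unitaryFundamentalRep (Fin N) ℂ)
    (isUnitaryModel_unitaryFundamentalRep N) hN

end Groups

end DiagRPHex

end

end Summit.QuantumFields.GaugeBoot
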